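import Literature.MathematicalPhysics.QuantumFieldTheory.Balaban1983to89.B6Prop22TwoLevelBox

/-!
# `Balaban1983to89.B6Prop22LapTwoLevelBox` — [B6] Proposition 2.2, SIXTH ENTRY of (2.67), `|(ΔG′λ)(x)| ≤
O(1)·1·e^{−½δ₀d(y,y′)}|λ|` («(L^jη)² replaced by 1»), FOR THE GENUINE TWO-LEVEL OPERATOR `Δ_Ω^{L^{−j},N} + m² + Q′*aQ′`
ON A BOX OF `L`-BLOCKS — uniformly in the mesh and the volume (file 8 of the two-level parametrix; nothing existing is
touched; no fact is minted)

FRAMING (verbatim cell line):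
statement-level skeleton of published theorems with citation tags; proofs where landed; nothing here is a claim about the Yang–Mills mass gap

Source under audit (cell pub-balaban): T. Bałaban, *Propagators and renormalization transformations for lattice gauge
theories. II*, Commun. Math. Phys. **96** (1984) 223–250 [`Balaban1984PropagatorsII`, "B6"], p. 234 [PDF 12] Proposition
2.2 (2.67) (render `b2b-balaban-ref1/pages/1984-cmp96-propagators-rt-II/…-p012-x2.png`, read as an image this generation),
p. 225 [PDF 3] (2.13)–(2.14) (the operator `Δ′_a = Δ^η_Ω + Q′*aQ′`).

## WHAT IS PRINTED (p. 234, verbatim up to notation)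

«Proposition 2.2. If we have (2.1), (2.2) and M is sufficiently large, then the operator G′ = Δ′_a^{−1}(a = 1) satisfies
the inequalities |(G′λ)(x)|, |(∇G′λ)(x)|, |(G′∇*λ)(x)|, ‖ζ∇G′λ‖_α, ‖ζG′∇*λ‖_α, |(ΔG′λ)(x)| ≤ O(1)[(L^jη)², L^jη, L^jη,
(L^jη)^{1−α}(‖ζ‖_α + |ζ|), (L^jη)^{1−α}(‖ζ‖_α + |ζ|), 1]·e^{−½δ₀d(y,y′)}|λ|, x ∈ B^j(y) …, supp λ ⊂ B^{j′}(y′) … (2.67)»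

## WHAT THIS FILE CERTIFIES (kernel-checked; `A = 0`; the lineage is USED, not re-proved)

Setting of `B6Prop22TwoLevelBox` (`n = L^k`, `ξ = 1/n`, `Ω` the box of `L`-blocks, `E = twoLevelOp = ξ^{−2}(−Δ^N_Ω) + m² +
Q′*aQ′`, `G′ = gTwoLevel = E^{−1}`).  The SIXTH entry of (2.67) is the Laplacian of the propagator, `ΔG′ = ξ^{−2}Δ^N_Ω·G′`:
* §1 `lapOp n` — the matrix `ξ^{−2}(−Δ^N_Ω)` (`B4Reflection242.neumannLapK` scaled), its action
  `(lapOp·f)(x) = ξ^{−2}Σ_{x′∼x, x′∈Ω}(f(x) − f(x′))` (`lapOp_mulVec`), and the decomposition of the genuine two-level operator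
  `E = lapOp + m²·1 + V` with `V` the averaging part (`twoLevelOp_eq_lapOp_add`, from `B6Ineq243TwoLevelBox.twoLevelOp_apply'`);
  the weighted rows of `V` are `≤ (a_j + a)e^{δL}` (`roww_vOp_le`);
* §2 **(2.67)₆ FOR THE GENUINE TWO-LEVEL BOX OPERATOR** `prop22_entry6_twoLevelBox`: there are `δ, M₀, C > 0` (functions
  of `d`, `ℓ`, window) such that for EVERY mesh `k ≥ 1`, `M_h ≥ 3` with `L·M_h ≥ M₀`, volume, block union, window point and
  site `x ∈ Ω`: `Σ_{x′}|(ξ^{−2}Δ^N_ΩG′)(x, x′)|e^{δ|x−x′|_∞/n} ≤ C` — from the defining equation `E·G′ = 1`, i.e.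
  `ξ^{−2}(−Δ^N_Ω)G′ = 1 − m²G′ − VG′`, the first entry (2.67)₁ (`B6Prop22TwoLevelBox.prop22_entry1_twoLevelBox`) and the
  weighted rows of `V`; the printed value form `gTwoLevel_lap_value_decay`:
  `|(ΔG′λ)(x)| ≤ Ce^{−δD/n}F` for `|λ| ≤ F` supported at sup-distance `≥ D` from `x`.

## HONEST SCOPE

As in `B6Prop22TwoLevelBox`: `k = 1` (two levels), `A = 0`, Neumann box for the torus, one cube size, existential
constants (`L^jη ↦ 1` in the lattice units of `twoLevelOp`).  Print does not say how the `ΔG′` entry is obtained; here it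
is read off the equation `Δ′_aG′ = I` and the first entry — a one-line consequence, recorded for completeness of the
non-Hölder entries of (2.67).  The Hölder entries are not treated.  Every step is kernel-checked.
-/

namespace Literature.MathematicalPhysics.QuantumFieldTheory.Balaban1983to89.B6Prop22LapTwoLevelBox

open Finset Matrix
open Literature.MathematicalPhysics.QuantumFieldTheory.Balaban1983to89.B4Reflection242 (boxDom mem_boxDom nbrs mem_nbrs
  neumannLapK diagK)
open Literature.MathematicalPhysics.QuantumFieldTheory.Balaban1983to89.B4Green242Bridge (boxNbrs not_mem_boxNbrs_self
  card_boxNbrs)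
open Literature.MathematicalPhysics.QuantumFieldTheory.Balaban1983to89.B4ContourShift (supNorm supNorm_nonneg)
open Literature.MathematicalPhysics.QuantumFieldTheory.Balaban1983to89.B4Lemma22ReduceZero (Box)
open Literature.MathematicalPhysics.QuantumFieldTheory.Balaban1983to89.B4Thm110ZeroBox (roww roww_nonneg roww_add_le
  roww_smul mulVec_le_of_roww)
open Literature.MathematicalPhysics.QuantumFieldTheory.Balaban1983to89.B6Ineq243TwoLevelBox
open Literature.MathematicalPhysics.QuantumFieldTheory.Balaban1983to89.B6Prop22TwoLevelBox

noncomputable section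

variable {d : ℕ}

/-! ## §1 The Laplacian of the `L^{−j}`-lattice on the box and the decomposition of the two-level operator -/

section Lap

variable {N : Fin (d + 1) → ℕ}

/-- **`ξ^{−2}(−Δ^N_Ω)`**, the Neumann Laplacian of the box on the `ξ = 1/n` lattice, as a real matrix (values form).
[cite: Balaban1984PropagatorsII, (2.13) p.225 («Δ^η_Ω … with Neumann boundary conditions»); Balaban1983RegularityDecay, (1.3) p.572] -/
def lapOp (n : ℕ) (N : Fin (d + 1) → ℕ) : Matrix ↥(boxDom N) ↥(boxDom N) ℝ :=
  Matrix.of fun x y => (n : ℝ) ^ 2 * (neumannLapK N x.1 y.1 : ℝ)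

/-- entries of `lapOp`. [cite: Balaban1983RegularityDecay, (1.3) p.572, dictionary] -/
theorem lapOp_apply (n : ℕ) (x y : ↥(boxDom N)) : lapOp n N x y = (n : ℝ) ^ 2 * (neumannLapK N x.1 y.1 : ℝ) := rfl

/-- **DICTIONARY**: `(ξ^{−2}(−Δ^N_Ω)f)(x) = ξ^{−2}Σ_{x′∼x, x′∈Ω}(f(x) − f(x′))` (the sum over the bonds of `Ω` at `x`).
[cite: Balaban1983RegularityDecay, (1.3) p.572] -/
theorem lapOp_mulVec (n : ℕ) (f : ↥(boxDom N) → ℝ) (x : ↥(boxDom N)) :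
    (lapOp n N *ᵥ f) x = (n : ℝ) ^ 2 * ∑ y ∈ boxNbrs N x, (f x - f y) := by
  classical
  have hL : ∑ y : ↥(boxDom N), (neumannLapK N x.1 y.1 : ℝ) * f y = ∑ y ∈ boxNbrs N x, (f x - f y) := by
    have hpt : ∀ y : ↥(boxDom N), (neumannLapK N x.1 y.1 : ℝ) * f y
        = (if y = x then ((boxNbrs N x).card : ℝ) * f x else 0) - (if y ∈ boxNbrs N x then f y else 0) := by
      intro y
      by_cases hyx : y = x
      · subst hyx
        simp [neumannLapK, not_mem_boxNbrs_self, card_boxNbrs]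
      · have hyx' : y.1 ≠ x.1 := fun h => hyx (Subtype.ext h)
        by_cases hyn : y.1 ∈ nbrs x.1
        · have hmem : y ∈ boxNbrs N x := by
            unfold boxNbrs; simp only [Finset.mem_filter, Finset.mem_univ, true_and]; exact hyn
          simp [neumannLapK, hyx, hyx', hyn, hmem]
        · have hmem : y ∉ boxNbrs N x := by
            unfold boxNbrs; simp only [Finset.mem_filter, Finset.mem_univ, true_and]; exact hyn
          simp [neumannLapK, hyx, hyx', hyn, hmem]
    simp_rw [hpt]
    rw [Finset.sum_sub_distrib, Finset.sum_ite_eq' Finset.univ x, if_pos (Finset.mem_univ _),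
      ← Finset.sum_filter, Finset.filter_mem_eq_inter, Finset.univ_inter, Finset.sum_sub_distrib,
      Finset.sum_const, nsmul_eq_mul]
  simp only [Matrix.mulVec, dotProduct, lapOp_apply]
  rw [← hL, Finset.mul_sum]
  exact Finset.sum_congr rfl fun y _ => by ring

/-- the weighted row of the identity kernel is `1`. [folklore] -/
private theorem roww_one (δ : ℝ) (n : ℕ) (x : ↥(boxDom N)) : roww δ n (1 : Matrix ↥(boxDom N) ↥(boxDom N) ℝ) x = 1 := by
  classical
  unfold roww
  rw [Finset.sum_eq_single x]
  · rw [Matrix.one_apply_eq, abs_one, one_mul, sub_self, B4BoxCov237.supNorm_zero', mul_zero, zero_div, Real.exp_zero]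
  · intro y _ hy
    rw [Matrix.one_apply_ne (Ne.symm hy), abs_zero, zero_mul]
  · intro h; exact absurd (Finset.mem_univ x) h

end Lap

section TwoLevel

variable {ℓ : ℕ}

/-- the AVERAGING PART `V = Q′*aQ′↾_Ω` of the genuine two-level operator as a matrix (`B6Ineq243TwoLevelBox.vEntry`).
[cite: Balaban1984PropagatorsII, (2.13)–(2.14) p.225, (2.40) p.230] -/
def vOp {n : ℕ} (hn : 1 ≤ n) (ℓ : ℕ) (aj a : ℝ) {M' : Fin (d + 1) → ℕ}
    (Λ : Finset ↥(boxDom (fun i => (ℓ + 1) * M' i))) :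
    Matrix ↥(boxDom (fun i => n * ((ℓ + 1) * M' i))) ↥(boxDom (fun i => n * ((ℓ + 1) * M' i))) ℝ :=
  Matrix.of fun x y => vEntry hn ℓ aj a Λ x y

/-- **`Δ′_a = ξ^{−2}(−Δ^N_Ω) + m² + Q′*aQ′`** as a matrix identity for the genuine two-level operator (`Λ` a union of
`L`-blocks). [cite: Balaban1984PropagatorsII, (2.13)–(2.14) p.225, (2.40)–(2.41) p.230] -/
theorem twoLevelOp_eq_lapOp_add {n : ℕ} (hn : 1 ≤ n) (aj a m2 : ℝ) {M' : Fin (d + 1) → ℕ}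
    {Λ : Finset ↥(boxDom (fun i => (ℓ + 1) * M' i))} (hΛ : IsBlockUnion ℓ M' Λ) :
    twoLevelOp n ℓ aj a m2 M' Λ = lapOp n _ + m2 • (1 : Matrix _ _ ℝ) + vOp hn ℓ aj a Λ := by
  ext x y
  rw [twoLevelOp_apply' hn aj a m2 hΛ x y, Matrix.add_apply, Matrix.add_apply, lapOp_apply, Matrix.smul_apply,
    smul_eq_mul]
  unfold vOp
  rw [Matrix.of_apply]
  congr 1
  congr 1
  simp only [diagK, Matrix.one_apply]
  by_cases h : y = x
  · subst h; simp
  · have h' : y.1 ≠ x.1 := fun e => h (Subtype.ext e)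
    rw [if_neg h', if_neg (Ne.symm h), mul_zero]

/-- the weighted rows of the averaging part: `Σ_y V(x,y)e^{δ|x−y|_∞/n} ≤ (a_j + a)e^{δL}` (entries `≥ 0`, supported in the
`(j+1)`-block of `x`, total weight `≤ a_j + a`). [cite: Balaban1984PropagatorsII, (2.14) p.225, (2.40) p.230] -/
theorem roww_vOp_le {n : ℕ} (hn : 1 ≤ n) {aj a : ℝ} (haj : 0 < aj) (ha : 0 ≤ a) {M' : Fin (d + 1) → ℕ}
    (Λ : Finset ↥(boxDom (fun i => (ℓ + 1) * M' i))) {δ : ℝ} (hδ : 0 ≤ δ)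
    (x : ↥(boxDom (fun i => n * ((ℓ + 1) * M' i)))) :
    roww δ n (vOp hn ℓ aj a Λ) x ≤ (aj + a) * Real.exp (δ * ((ℓ : ℝ) + 1)) := by
  have hn' : (0 : ℝ) < n := by exact_mod_cast hn
  unfold roww vOp
  simp only [Matrix.of_apply]
  have hpt : ∀ y, |vEntry hn ℓ aj a Λ x y| * Real.exp (δ * supNorm (x.1 - y.1) / n)
      ≤ vEntry hn ℓ aj a Λ x y * Real.exp (δ * ((ℓ : ℝ) + 1)) := by
    intro y
    rw [abs_of_nonneg (vEntry_nonneg hn ℓ haj ha Λ x y)]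
    by_cases hv : vEntry hn ℓ aj a Λ x y = 0
    · rw [hv, zero_mul, zero_mul]
    · refine mul_le_mul_of_nonneg_left (Real.exp_le_exp.2 ?_) (vEntry_nonneg hn ℓ haj ha Λ x y)
      have hd := supNorm_le_of_vEntry_ne_zero hn ℓ aj a Λ hv
      rw [div_le_iff₀ hn']
      calc δ * supNorm (x.1 - y.1) ≤ δ * ((n : ℝ) * ((ℓ : ℝ) + 1)) := mul_le_mul_of_nonneg_left hd hδ
        _ = δ * ((ℓ : ℝ) + 1) * n := by ring
  refine (Finset.sum_le_sum fun y _ => hpt y).trans ?_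
  rw [← Finset.sum_mul]
  exact mul_le_mul_of_nonneg_right (sum_vEntry_le hn haj ha Λ x) (Real.exp_pos _).le

end TwoLevel

/-! ## §2 (2.67)₆: the Laplacian of the propagator, `ξ^{−2}Δ^N_Ω·G′ = −(1 − m²G′ − VG′)` -/

section Prop22Lap

variable {ℓ k Mh : ℕ} {P : Fin (d + 1) → ℕ}

/-- **THE EQUATION**: `ξ^{−2}(−Δ^N_Ω)·G′ = 1 − m²G′ − VG′` (`Δ′_aG′ = I`). [cite: Balaban1984PropagatorsII, (2.13) p.225, Proposition 2.2 p.234] -/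
theorem lapOp_mul_gTwoLevel (hℓ : 1 ≤ ℓ) (hMh : 1 ≤ Mh) (hP : ∀ i, 1 ≤ P i) {aj a m2 : ℝ}
    (haj : 0 < aj) (ha : 0 < a) (hm : 0 ≤ m2) {Λ : Finset ↥(boxDom (fun i => (ℓ + 1) * (Mh * P i)))}
    (hΛ : IsBlockUnion ℓ (fun i => Mh * P i) Λ) :
    lapOp ((ℓ + 1) ^ k) _ * gTwoLevel ((ℓ + 1) ^ k) ℓ aj a m2 (fun i => Mh * P i) Λ
      = 1 - m2 • gTwoLevel ((ℓ + 1) ^ k) ℓ aj a m2 (fun i => Mh * P i) Λ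
          - vOp (Nat.one_le_pow _ _ (by omega)) ℓ aj a Λ * gTwoLevel ((ℓ + 1) ^ k) ℓ aj a m2 (fun i => Mh * P i) Λ := by
  have hn1 : 1 ≤ (ℓ + 1) ^ k := Nat.one_le_pow _ _ (by omega)
  have hEG : twoLevelOp ((ℓ + 1) ^ k) ℓ aj a m2 (fun i => Mh * P i) Λ
      * gTwoLevel ((ℓ + 1) ^ k) ℓ aj a m2 (fun i => Mh * P i) Λ = 1 :=
    twoLevelOp_mul_gTwoLevel hn1 hℓ haj ha hm
      (fun i => Nat.one_le_iff_ne_zero.2 (Nat.mul_ne_zero_iff.2 ⟨by omega, by have := hP i; omega⟩)) hΛ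
  rw [twoLevelOp_eq_lapOp_add hn1 aj a m2 hΛ, Matrix.add_mul, Matrix.add_mul, Matrix.smul_mul, Matrix.one_mul] at hEG
  rw [← hEG]
  abel

/-- **[B6] PROPOSITION 2.2, SIXTH ENTRY OF (2.67) (`ΔG′`, «(L^jη)² replaced by 1»), FOR THE GENUINE TWO-LEVEL OPERATOR
ON A BOX**: there are `δ, M₀, C > 0` (functions of `d`, `ℓ` and the window) such that for EVERY mesh `k ≥ 1`, `M_h ≥ 3`
with `L·M_h ≥ M₀`, volume `P`, block union `Λ`, window point and site `x ∈ Ω`: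
`Σ_{x′}|(ξ^{−2}Δ^N_ΩG′)(x, x′)|e^{δ|x−x′|_∞/n} ≤ C` for `G′ = (Δ_Ω^{L^{−j},N} + m² + Q′*aQ′)^{−1}` — from
`ξ^{−2}(−Δ^N_Ω)G′ = 1 − m²G′ − VG′`, the first entry (2.67)₁ (`B6Prop22TwoLevelBox.prop22_entry1_twoLevelBox`) and the
weighted rows of the averaging part `V` (`roww_vOp_le`). [cite: Balaban1984PropagatorsII, Proposition 2.2 (2.67) p.234] -/
theorem prop22_entry6_twoLevelBox (d ℓ : ℕ) (hℓ : 1 ≤ ℓ) (aminus aplus m2plus a2minus a2plus : ℝ) (ha : 0 < aminus)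
    (ha2 : 0 < a2minus) :
    ∃ δ M₀ C : ℝ, 0 < δ ∧ 0 < M₀ ∧ 0 < C ∧ ∀ (k : ℕ), 1 ≤ k → ∀ (aj m2 a : ℝ), aminus ≤ aj → aj ≤ aplus → 0 ≤ m2 →
      m2 ≤ m2plus → a2minus ≤ a → a ≤ a2plus → ∀ (Mh : ℕ), 3 ≤ Mh → M₀ ≤ ((ℓ : ℝ) + 1) * Mh →
        ∀ (P : Fin (d + 1) → ℕ), (∀ i, 1 ≤ P i) → ∀ (Λ : Finset ↥(boxDom (fun i => (ℓ + 1) * (Mh * P i)))),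
        IsBlockUnion ℓ (fun i => Mh * P i) Λ →
        ∀ x : ↥(Box d ℓ k (fun i => (ℓ + 1) * (Mh * P i))),
          roww δ ((ℓ + 1) ^ k) (lapOp ((ℓ + 1) ^ k) _ * gTwoLevel ((ℓ + 1) ^ k) ℓ aj a m2 (fun i => Mh * P i) Λ) x
            ≤ C := by
  obtain ⟨δ, M₀, C, hδ, hM₀, hC, h⟩ := prop22_entry1_twoLevelBox d ℓ hℓ aminus aplus m2plus a2minus a2plus ha ha2
  refine ⟨δ, M₀, 1 + |m2plus| * C + (|aplus| + |a2plus|) * Real.exp (δ * ((ℓ : ℝ) + 1)) * C, hδ, hM₀, by positivity, ?_⟩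
  intro k hk aj m2 a e1 e2 e3 e4 e5 e6 Mh hMh hM P hP Λ hΛ x
  have hMh1 : 1 ≤ Mh := le_trans (by norm_num) hMh
  have hn1 : 1 ≤ (ℓ + 1) ^ k := Nat.one_le_pow _ _ (by omega)
  have haj : 0 < aj := lt_of_lt_of_le ha e1
  have ha0 : 0 < a := lt_of_lt_of_le ha2 e5
  set G := gTwoLevel ((ℓ + 1) ^ k) ℓ aj a m2 (fun i => Mh * P i) Λ with hG
  have hGrow : ∀ z, roww δ ((ℓ + 1) ^ k) G z ≤ C := fun z => h k hk aj m2 a e1 e2 e3 e4 e5 e6 Mh hMh hM P hP Λ hΛ z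
  have hV : ∀ z, roww δ ((ℓ + 1) ^ k) (vOp hn1 ℓ aj a Λ) z ≤ (|aplus| + |a2plus|) * Real.exp (δ * ((ℓ : ℝ) + 1)) := by
    intro z
    refine (roww_vOp_le hn1 haj ha0.le Λ hδ.le z).trans ?_
    have : aj + a ≤ |aplus| + |a2plus| := add_le_add (e2.trans (le_abs_self _)) (e6.trans (le_abs_self _))
    exact mul_le_mul_of_nonneg_right this (Real.exp_pos _).le
  rw [lapOp_mul_gTwoLevel hℓ hMh1 hP haj ha0 e3 hΛ, ← hG]
  have hsub : ∀ (A B : Matrix ↥(Box d ℓ k (fun i => (ℓ + 1) * (Mh * P i))) ↥(Box d ℓ k (fun i => (ℓ + 1) * (Mh * P i))) ℝ)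
      (z : ↥(Box d ℓ k (fun i => (ℓ + 1) * (Mh * P i)))),
      roww δ ((ℓ + 1) ^ k) (A - B) z ≤ roww δ ((ℓ + 1) ^ k) A z + roww δ ((ℓ + 1) ^ k) B z := by
    intro A B z
    rw [sub_eq_add_neg]
    refine (roww_add_le _ _ _ _ _).trans (le_of_eq ?_)
    congr 1
    unfold roww
    exact Finset.sum_congr rfl fun y _ => by rw [Matrix.neg_apply, abs_neg]
  have h1 : roww δ ((ℓ + 1) ^ k) (1 : Matrix _ _ ℝ) x = 1 := roww_one δ _ x
  have h2 : roww δ ((ℓ + 1) ^ k) (m2 • G) x ≤ |m2plus| * C := by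
    rw [roww_smul _ _ e3]
    exact mul_le_mul (e4.trans (le_abs_self _)) (hGrow x) (roww_nonneg _ _ _ _) (abs_nonneg _)
  have h3 : roww δ ((ℓ + 1) ^ k) (vOp hn1 ℓ aj a Λ * G) x ≤ (|aplus| + |a2plus|) * Real.exp (δ * ((ℓ : ℝ) + 1)) * C :=
    (roww_mul_le hδ.le _ _ _ hGrow x).trans (mul_le_mul_of_nonneg_right (hV x) hC.le)
  calc roww δ ((ℓ + 1) ^ k) (1 - m2 • G - vOp hn1 ℓ aj a Λ * G) x
      ≤ roww δ ((ℓ + 1) ^ k) (1 - m2 • G) x + roww δ ((ℓ + 1) ^ k) (vOp hn1 ℓ aj a Λ * G) x := hsub _ _ x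
    _ ≤ (roww δ ((ℓ + 1) ^ k) (1 : Matrix _ _ ℝ) x + roww δ ((ℓ + 1) ^ k) (m2 • G) x)
        + roww δ ((ℓ + 1) ^ k) (vOp hn1 ℓ aj a Λ * G) x := add_le_add (hsub _ _ x) le_rfl
    _ ≤ 1 + |m2plus| * C + (|aplus| + |a2plus|) * Real.exp (δ * ((ℓ : ℝ) + 1)) * C := by
        rw [h1]; exact add_le_add (add_le_add le_rfl h2) h3

/-- **THE PRINTED VALUE FORM OF (2.67)₆**: `|(ΔG′λ)(x)| = |(ξ^{−2}Δ^N_Ω(G′λ))(x)| ≤ Ce^{−δD/n}F` for `|λ| ≤ F` supported at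
sup-distance `≥ D` from `x` («|(ΔG′λ)(x)| ≤ O(1)·1·e^{−½δ₀d(y,y′)}|λ|»), same uniformity.
[cite: Balaban1984PropagatorsII, Proposition 2.2 (2.67) p.234] -/
theorem gTwoLevel_lap_value_decay (d ℓ : ℕ) (hℓ : 1 ≤ ℓ) (aminus aplus m2plus a2minus a2plus : ℝ) (ha : 0 < aminus)
    (ha2 : 0 < a2minus) :
    ∃ δ M₀ C : ℝ, 0 < δ ∧ 0 < M₀ ∧ 0 < C ∧ ∀ (k : ℕ), 1 ≤ k → ∀ (aj m2 a : ℝ), aminus ≤ aj → aj ≤ aplus → 0 ≤ m2 →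
      m2 ≤ m2plus → a2minus ≤ a → a ≤ a2plus → ∀ (Mh : ℕ), 3 ≤ Mh → M₀ ≤ ((ℓ : ℝ) + 1) * Mh →
        ∀ (P : Fin (d + 1) → ℕ), (∀ i, 1 ≤ P i) → ∀ (Λ : Finset ↥(boxDom (fun i => (ℓ + 1) * (Mh * P i)))),
        IsBlockUnion ℓ (fun i => Mh * P i) Λ →
        ∀ (f : ↥(Box d ℓ k (fun i => (ℓ + 1) * (Mh * P i))) → ℝ) (F D : ℝ), (∀ x', |f x'| ≤ F) →
        ∀ x : ↥(Box d ℓ k (fun i => (ℓ + 1) * (Mh * P i))), (∀ x', f x' ≠ 0 → D ≤ supNorm (x.1 - x'.1)) →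
          |(lapOp ((ℓ + 1) ^ k) _ *ᵥ (gTwoLevel ((ℓ + 1) ^ k) ℓ aj a m2 (fun i => Mh * P i) Λ *ᵥ f)) x|
            ≤ C * Real.exp (-(δ * D / (((ℓ + 1) ^ k : ℕ) : ℝ))) * F := by
  obtain ⟨δ, M₀, C, hδ, hM₀, hC, h⟩ := prop22_entry6_twoLevelBox d ℓ hℓ aminus aplus m2plus a2minus a2plus ha ha2
  refine ⟨δ, M₀, C, hδ, hM₀, hC, ?_⟩
  intro k hk aj m2 a e1 e2 e3 e4 e5 e6 Mh hMh hM P hP Λ hΛ f F D hF x hD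
  rw [Matrix.mulVec_mulVec]
  exact mulVec_le_of_roww hδ.le _ _ x (h k hk aj m2 a e1 e2 e3 e4 e5 e6 Mh hMh hM P hP Λ hΛ x) f hF hD

end Prop22Lap

/-! ## §3 Non-vacuity (`d + 1 = 4`, `L = 2`, windows `a_j ∈ [1/2, 2]`, `m² ∈ [0, 1]`, `a ∈ [1/2, 2]`) -/

/-- (2.67)₆ at the physical dimension `d + 1 = 4`, `L = 2`. -/
example : ∃ δ M₀ C : ℝ, 0 < δ ∧ 0 < M₀ ∧ 0 < C ∧ ∀ (k : ℕ), 1 ≤ k → ∀ (aj m2 a : ℝ), (1 / 2 : ℝ) ≤ aj → aj ≤ 2 →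
    0 ≤ m2 → m2 ≤ 1 → (1 / 2 : ℝ) ≤ a → a ≤ 2 → ∀ (Mh : ℕ), 3 ≤ Mh → M₀ ≤ (((1 : ℕ) : ℝ) + 1) * Mh →
      ∀ (P : Fin (3 + 1) → ℕ), (∀ i, 1 ≤ P i) → ∀ (Λ : Finset ↥(boxDom (fun i => (1 + 1) * (Mh * P i)))),
      IsBlockUnion 1 (fun i => Mh * P i) Λ →
      ∀ x : ↥(Box 3 1 k (fun i => (1 + 1) * (Mh * P i))),
        roww δ ((1 + 1) ^ k) (lapOp ((1 + 1) ^ k) _ * gTwoLevel ((1 + 1) ^ k) 1 aj a m2 (fun i => Mh * P i) Λ) x ≤ C :=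
  prop22_entry6_twoLevelBox 3 1 le_rfl (1 / 2) 2 1 (1 / 2) 2 (by norm_num) (by norm_num)

/-- the dictionary lemma is non-vacuous: on the smallest box the Laplacian of a constant vanishes. -/
example (x : ↥(boxDom (fun _ : Fin (3 + 1) => 2))) : (lapOp 2 (fun _ : Fin (3 + 1) => 2) *ᵥ (fun _ => (1 : ℝ))) x = 0 := by
  rw [lapOp_mulVec]
  simp

end

end Literature.MathematicalPhysics.QuantumFieldTheory.Balaban1983to89.B6Prop22LapTwoLevelBox
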